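import Mathlib.Analysis.SpecificLimits.Normed
import Mathlib.Analysis.Normed.Module.FiniteDimension
import Literature.Probability.RandomPlanarGeometry.ConformalRemovabilityMeanPorous
import Literature.Probability.RandomPlanarGeometry.ConformalRemovabilityPorosity
import HarnessLib

/-!
# Conformal removability: the summability `Σ_Q q(Q)² l(Q)² < ∞` for Hölder domains

Support for the proof of `JonesSmirnov2000_frontier_of_isHolderDomain` (Jones–Smirnov 2000,
Cor. 2; `ConformalRemovability.lean`). The hypothesis of Jones–Smirnov's Theorem 2 (Ark. Mat. 38
(2000), p. 267, (2): `dist_qh(·, z₀) ∈ L²(Ω)`, i.e. `Σ_Q q(Q)² |Q| < ∞` over the Whitney cubes,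
p. 274) holds for Hölder domains. In the paper this is Theorem 3 / Corollary 4, proved with the
Marcinkiewicz-integral estimate of Jones–Makarov [JM]; here it follows from the two previous files:
the boundary is uniformly mean porous (`meanPorous_frontier_of_holderOnWith`), hence its dyadic
neighbourhoods have exponentially small area (`volume_thickening_le_of_meanPorous`), hence there
are few Whitney discs of each size, which beats the linear growth `q ≲ log(1/dist(·, ∂Ω))` of the
quasihyperbolic boundary condition.

* `volume_frontier_eq_zero_of_holderOnWith` — `area(∂Ω) = 0` for a Hölder domain;
* `card_le_of_whitney_class` — discs `B(x, dist(x, Ωᶜ)/400)`, `x ∈ F`, pairwise disjoint with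
  `D/2^{j+1} < dist(x, Ωᶜ) ≤ D/2^j`: `|F| ≤ N_j` with `Σ_j N_j (a j + b)² 4^{-j} < ∞`;
* `summable_sq_mul_sq_of_qhbc` — MAIN: for a countable `S ⊆ Ω` with the discs
  `B(x, dist(x, Ωᶜ)/400)` pairwise disjoint (a Whitney family with `r = dist(·, Ωᶜ)/100`) and any
  `q : ℂ → ℕ` with `q x ≤ A log(1/dist(x, Ωᶜ)) + B` on `S` (the quasihyperbolic boundary
  condition), `Σ_{x ∈ S} (q x + 1)² (dist(x, Ωᶜ)/100)² < ∞` — the hypothesis `hsum` of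
  `exists_tailSup` / `exists_ray_tendsto`.

## References

* [JonesSmirnov2000] P. W. Jones, S. K. Smirnov, Ark. Mat. 38 (2000) 263–279, Thm. 2 (2), Thm. 3,
  Cor. 2 and Cor. 4 (pp. 267–268).
* P. Koskela, S. Rohde, Math. Ann. 309 (1997) 593–609 (the route used here).
-/

noncomputable section

open Set Filter Metric MeasureTheory Finset
open scoped Topology NNReal ENNReal BigOperators

namespace Literature.Probability.RandomPlanarGeometry

variable {Ω : Set ℂ}

/-! ### The boundary has area zero -/

/-- **The boundary of a Hölder domain has area zero** (it is uniformly mean porous, so its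
`2^{-n}`-neighbourhoods have area `≤ C θⁿ → 0`). (Jones–Smirnov 2000, p. 266: "boundaries of such
domains have zero Lebesgue volume".) [cite: JonesSmirnov2000, p. 266] -/
theorem volume_frontier_eq_zero_of_holderOnWith (φ : ConformalEquiv (ball (0 : ℂ) 1) Ω)
    {C α : ℝ≥0} (hα : 0 < α) (hH : HolderOnWith C α φ (ball (0 : ℂ) 1)) :
    volume (frontier Ω) = 0 := by
  obtain ⟨η, k₁, n₀, hη, hk₁, hpor⟩ := meanPorous_frontier_of_holderOnWith φ hα hH
  have hbd : Bornology.IsBounded (frontier Ω) :=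
    (isBounded_of_holderOnWith φ hH).closure.subset frontier_subset_closure
  obtain ⟨C₀, θ, hC₀, hθ0, hθ1, hvol⟩ :=
    volume_thickening_le_of_meanPorous hbd hη (by norm_num : (0 : ℝ) < 1 / 2) hk₁ hpor
  refine le_antisymm ?_ bot_le
  refine ge_of_tendsto' (?_ : Tendsto (fun n : ℕ => ENNReal.ofReal (C₀ * θ ^ (n + max n₀ k₁)))
      atTop (𝓝 0)) fun n => ?_
  · rw [← ENNReal.ofReal_zero]
    refine ENNReal.tendsto_ofReal ?_
    have := (tendsto_pow_atTop_nhds_zero_of_lt_one hθ0 hθ1).comp (tendsto_add_atTop_nat (max n₀ k₁))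
    simpa using this.const_mul C₀
  · calc volume (frontier Ω) ≤ volume (thickening (1 / 2 ^ (n + max n₀ k₁)) (frontier Ω)) :=
          measure_mono (self_subset_thickening (by positivity) _)
      _ ≤ ENNReal.ofReal (C₀ * θ ^ (n + max n₀ k₁)) :=
          hvol _ (le_trans (le_max_left _ _) (Nat.le_add_left _ _))
            (le_trans (le_max_right _ _) (Nat.le_add_left _ _))

/-! ### Counting disjoint discs inside a set of small area -/

/-- **Packing count**: pairwise disjoint discs `B(x, ρ x)`, `x ∈ F`, of radii `≥ ρ₀` inside a set
of area `≤ V` number at most `V / (π ρ₀²)`. [folklore] -/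
theorem card_mul_le_of_disjoint_balls {F : Finset ℂ} {ρ : ℂ → ℝ} {ρ₀ V : ℝ} (hρ₀ : 0 < ρ₀)
    (hV : 0 ≤ V) (hρ : ∀ x ∈ F, ρ₀ ≤ ρ x)
    (hdisj : (F : Set ℂ).PairwiseDisjoint fun x => ball x (ρ x)) {T : Set ℂ}
    (hsub : ∀ x ∈ F, ball x (ρ x) ⊆ T) (hT : volume T ≤ ENNReal.ofReal V) :
    (F.card : ℝ) * (Real.pi * ρ₀ ^ 2) ≤ V := by
  have h1 : ∑ x ∈ F, volume (ball x (ρ x)) = volume (⋃ x ∈ F, ball x (ρ x)) :=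
    (measure_biUnion_finset hdisj fun x _ => measurableSet_ball).symm
  have hball : ∀ x : ℂ, ENNReal.ofReal (Real.pi * ρ₀ ^ 2) = volume (ball x ρ₀) := fun x => by
    rw [Complex.volume_ball, ← ENNReal.ofReal_pow hρ₀.le,
      show ((NNReal.pi : NNReal) : ℝ≥0∞) = ENNReal.ofReal Real.pi from by
        rw [← ENNReal.ofReal_coe_nnreal, NNReal.coe_real_pi],
      ← ENNReal.ofReal_mul (by positivity), mul_comm]
  have h2 : (F.card : ℝ≥0∞) * ENNReal.ofReal (Real.pi * ρ₀ ^ 2) ≤ ENNReal.ofReal V := by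
    calc (F.card : ℝ≥0∞) * ENNReal.ofReal (Real.pi * ρ₀ ^ 2)
        = ∑ x ∈ F, ENNReal.ofReal (Real.pi * ρ₀ ^ 2) := by rw [Finset.sum_const, nsmul_eq_mul]
      _ ≤ ∑ x ∈ F, volume (ball x (ρ x)) := Finset.sum_le_sum fun x hx => by
          rw [hball x]
          exact measure_mono (ball_subset_ball (hρ x hx))
      _ = volume (⋃ x ∈ F, ball x (ρ x)) := h1
      _ ≤ volume T := measure_mono (Set.iUnion₂_subset hsub)
      _ ≤ ENNReal.ofReal V := hT
  have h3 : ENNReal.ofReal ((F.card : ℝ) * (Real.pi * ρ₀ ^ 2)) ≤ ENNReal.ofReal V := by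
    rwa [ENNReal.ofReal_mul (Nat.cast_nonneg _), ENNReal.ofReal_natCast]
  exact (ENNReal.ofReal_le_ofReal_iff hV).1 h3

/-! ### The summability -/

/-- **`Σ_Q q(Q)² l(Q)² < ∞` for Hölder domains** (Jones–Smirnov 2000, hypothesis (2) of Thm. 2
with `n = 2`, established for Hölder domains in Thm. 3/Cor. 4 via [JM]; here via mean porosity).
Let `φ : 𝔻 → Ω` be a Hölder continuous conformal equivalence, `S ⊆ Ω` countable with the discs
`B(x, dist(x, Ωᶜ)/400)` pairwise disjoint (e.g. the centres of a Whitney family of radius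
`dist(·, Ωᶜ)/100`), and `q : ℂ → ℕ` with `q x ≤ A log(1/dist(x, Ωᶜ)) + B` on `S` (`A ≥ 0`; the
quasihyperbolic boundary condition for the graph distance). Then
`Σ_{x ∈ S} (q x + 1)² (dist(x, Ωᶜ)/100)² < ∞`. Proof: sort `S` into classes
`D/2^{j+1} < dist(x, Ωᶜ) ≤ D/2^j`; the discs of class `j` lie in the `2^{j_D - j}`-neighbourhood
of `∂Ω`, of area `≤ C₀ θ^{j - j_D}` (`volume_thickening_le_of_meanPorous` with
`meanPorous_frontier_of_holderOnWith`), so class `j` has `≲ 4^j θ^j` members, each contributing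
`≲ (A j + B)² 4^{-j}`. [cite: JonesSmirnov2000, Thm. 2 (2) and Cor. 4 (pp. 267–268)] -/
theorem summable_sq_mul_sq_of_qhbc (φ : ConformalEquiv (ball (0 : ℂ) 1) Ω) {C α : ℝ≥0}
    (hα : 0 < α) (hH : HolderOnWith C α φ (ball (0 : ℂ) 1)) {S : Set ℂ} (hSΩ : S ⊆ Ω)
    (hdisj : S.PairwiseDisjoint fun x => ball x (infDist x Ωᶜ / 400)) {q : ℂ → ℕ} {A B : ℝ}
    (hA : 0 ≤ A) (hq : ∀ x ∈ S, (q x : ℝ) ≤ A * Real.log (1 / infDist x Ωᶜ) + B) :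
    Summable fun x : S => ((q x : ℝ) + 1) ^ 2 * (infDist (x : ℂ) Ωᶜ / 100) ^ 2 := by
  classical
  -- porosity and the area bound for the boundary
  obtain ⟨η, k₁, n₀, hη, hk₁, hpor⟩ := meanPorous_frontier_of_holderOnWith φ hα hH
  have hΩo := isOpen_of_conformalEquiv_ball φ
  have hΩc : Ωᶜ.Nonempty := compl_nonempty_of_holderOnWith φ hH
  have hΩne : Ω ≠ univ := fun h => by simp [h] at hΩc
  have hbdΩ := isBounded_of_holderOnWith φ hH
  have hbd : Bornology.IsBounded (frontier Ω) := hbdΩ.closure.subset frontier_subset_closure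
  obtain ⟨C₀, θ, hC₀, hθ0, hθ1, hvol⟩ :=
    volume_thickening_le_of_meanPorous hbd hη (by norm_num : (0 : ℝ) < 1 / 2) hk₁ hpor
  set n₁ : ℕ := max n₀ k₁ with hn₁
  -- the size of the domain
  set D : ℝ := 4 * (C : ℝ) + 2 with hD
  have hD1 : 1 ≤ D := by simp only [hD]; linarith [C.coe_nonneg]
  have hD0 : 0 < D := by linarith
  have hsubD : Ω ⊆ closedBall (φ 0) C := subset_closedBall_of_holderOnWith φ hH
  -- distances to the complement
  have hdpos : ∀ x ∈ S, 0 < infDist x Ωᶜ := fun x hx => by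
    rw [← infDist_pos_iff_notMem_closure hΩc, hΩo.isClosed_compl.closure_eq]
    exact fun h => h (hSΩ hx)
  have hdle : ∀ x ∈ S, infDist x Ωᶜ ≤ D / 2 := by
    intro x hx
    have hp : φ 0 + ((C : ℝ) + 1 : ℝ) ∈ Ωᶜ := by
      intro h
      have := hsubD h
      rw [mem_closedBall, dist_eq_norm, add_sub_cancel_left, Complex.norm_real, Real.norm_eq_abs,
        abs_of_nonneg (by positivity)] at this
      linarith
    calc infDist x Ωᶜ ≤ dist x (φ 0 + ((C : ℝ) + 1 : ℝ)) := infDist_le_dist_of_mem hp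
      _ ≤ dist x (φ 0) + dist (φ 0) (φ 0 + ((C : ℝ) + 1 : ℝ)) := dist_triangle _ _ _
      _ ≤ C + ((C : ℝ) + 1) := by
          gcongr
          · exact mem_closedBall.1 (hsubD (hSΩ hx))
          · rw [dist_eq_norm, sub_add_cancel_left, norm_neg, Complex.norm_real, Real.norm_eq_abs,
              abs_of_nonneg (by positivity)]
      _ = D / 2 := by rw [hD]; ring
  -- the class index `j x`: `2^j ≤ D / d x < 2^(j+1)`
  have hjex : ∀ x : ℂ, ∃ j : ℕ, x ∈ S → ((2 : ℝ) ^ j ≤ D / infDist x Ωᶜ ∧ D / infDist x Ωᶜ < 2 ^ (j + 1)) := by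
    intro x
    by_cases hx : x ∈ S
    · have h1 : (1 : ℝ) ≤ D / infDist x Ωᶜ := by
        rw [le_div_iff₀ (hdpos x hx)]; linarith [hdle x hx]
      obtain ⟨j, hj⟩ := exists_nat_pow_near h1 one_lt_two
      exact ⟨j, fun _ => hj⟩
    · exact ⟨0, fun h => (hx h).elim⟩
  choose jOf hjOf using hjex
  have hclass : ∀ x ∈ S, D / 2 ^ (jOf x + 1) < infDist x Ωᶜ ∧ infDist x Ωᶜ ≤ D / 2 ^ jOf x := by
    intro x hx
    obtain ⟨h1, h2⟩ := hjOf x hx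
    have hd := hdpos x hx
    constructor
    · rw [div_lt_iff₀ (by positivity)]
      rw [div_lt_iff₀ hd] at h2
      linarith
    · rw [le_div_iff₀ (by positivity)]
      rw [le_div_iff₀ hd] at h1
      linarith
  -- the dyadic shift `j_D`: `2 D ≤ 2^{j_D}`
  obtain ⟨jD, hjD⟩ := pow_unbounded_of_one_lt (2 * D) (one_lt_two (α := ℝ))
  -- discs of class `j ≥ jD` lie in the `2^{jD-j}`-neighbourhood of the boundary
  have hthick : ∀ x ∈ S, jD ≤ jOf x →
      ball x (infDist x Ωᶜ / 400) ⊆ thickening (1 / 2 ^ (jOf x - jD)) (frontier Ω) := by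
    intro x hx hjx z hz
    obtain ⟨y, hy, hyd⟩ := exists_mem_frontier_infDist_compl_eq_dist (hSΩ hx) hΩne
    rw [mem_thickening_iff]
    refine ⟨y, hy, ?_⟩
    rw [mem_ball] at hz
    have h1 := (hclass x hx).2
    have h2 : dist z y ≤ dist z x + infDist x Ωᶜ := by rw [hyd]; exact dist_triangle _ _ _
    have h3 : infDist x Ωᶜ / 400 + infDist x Ωᶜ < 1 / 2 ^ (jOf x - jD) := by
      have h4 : infDist x Ωᶜ / 400 + infDist x Ωᶜ ≤ 2 * D / 2 ^ jOf x := by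
        rw [le_div_iff₀ (by positivity)]
        rw [le_div_iff₀ (by positivity)] at h1
        nlinarith [hdpos x hx]
      have h5 : 2 * D / 2 ^ jOf x < 1 / 2 ^ (jOf x - jD) := by
        rw [div_lt_div_iff₀ (by positivity) (by positivity), one_mul]
        have : (2 : ℝ) ^ jOf x = 2 ^ (jOf x - jD) * 2 ^ jD := by
          rw [← pow_add]; congr 1; omega
        rw [this]
        have hp : (0 : ℝ) < 2 ^ (jOf x - jD) := by positivity
        nlinarith
      linarith
    linarith
  -- all discs lie in a fixed big disc
  have hbig : ∀ x ∈ S, ball x (infDist x Ωᶜ / 400) ⊆ closedBall (φ 0) D := by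
    intro x hx z hz
    rw [mem_ball] at hz
    rw [mem_closedBall]
    have h1 : dist x (φ 0) ≤ C := mem_closedBall.1 (hsubD (hSΩ hx))
    have h2 := hdle x hx
    calc dist z (φ 0) ≤ dist z x + dist x (φ 0) := dist_triangle _ _ _
      _ ≤ D := by rw [hD] at *; linarith
  set V₀ : ℝ := (volume (closedBall (φ 0) D)).toReal with hV₀
  have hV₀fin : volume (closedBall (φ 0) D) ≠ ∞ := (isCompact_closedBall _ _).measure_lt_top.ne
  -- the class bounds `N j`
  set N : ℕ → ℝ := fun j => if jD + n₁ ≤ j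
    then C₀ * θ ^ (j - jD) / (Real.pi * (D / 2 ^ (j + 1) / 400) ^ 2)
    else V₀ / (Real.pi * (D / 2 ^ (j + 1) / 400) ^ 2) with hN
  have hN0 : ∀ j, 0 ≤ N j := fun j => by
    simp only [hN]
    split_ifs <;> positivity
  -- CLASS COUNT: a finite family of class-`j` centres has at most `N j` members
  have hcount : ∀ (j : ℕ) (F : Finset ℂ), (∀ x ∈ F, x ∈ S ∧ jOf x = j) → (F.card : ℝ) ≤ N j := by
    intro j F hF
    have hρ₀ : (0 : ℝ) < D / 2 ^ (j + 1) / 400 := by positivity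
    have hρ : ∀ x ∈ F, D / 2 ^ (j + 1) / 400 ≤ infDist x Ωᶜ / 400 := fun x hx => by
      have := (hclass x (hF x hx).1).1
      rw [(hF x hx).2] at this
      linarith
    have hdisjF : (F : Set ℂ).PairwiseDisjoint fun x => ball x (infDist x Ωᶜ / 400) :=
      hdisj.subset fun x hx => (hF x (Finset.mem_coe.1 hx)).1
    by_cases hj : jD + n₁ ≤ j
    · have hvolj : volume (thickening (1 / 2 ^ (j - jD)) (frontier Ω)) ≤
          ENNReal.ofReal (C₀ * θ ^ (j - jD)) :=
        hvol (j - jD) (by omega) (by omega)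
      have hsubF : ∀ x ∈ F, ball x (infDist x Ωᶜ / 400) ⊆ thickening (1 / 2 ^ (j - jD)) (frontier Ω) :=
        fun x hx => by
          have := hthick x (hF x hx).1 (by rw [(hF x hx).2]; omega)
          rwa [(hF x hx).2] at this
      have h := card_mul_le_of_disjoint_balls hρ₀ (by positivity) hρ hdisjF hsubF hvolj
      simp only [hN, if_pos hj]
      rw [le_div_iff₀ (by positivity)]
      exact h
    · have hvolj : volume (closedBall (φ 0) D) ≤ ENNReal.ofReal V₀ := by
        rw [hV₀, ENNReal.ofReal_toReal hV₀fin]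
      have hsubF : ∀ x ∈ F, ball x (infDist x Ωᶜ / 400) ⊆ closedBall (φ 0) D :=
        fun x hx => hbig x (hF x hx).1
      have h := card_mul_le_of_disjoint_balls hρ₀ ENNReal.toReal_nonneg hρ hdisjF hsubF hvolj
      simp only [hN, if_neg hj]
      rw [le_div_iff₀ (by positivity)]
      exact h
  -- the per-point weights `w j`
  set L₀ : ℝ := |Real.log (1 / D)| with hL₀
  set w : ℕ → ℝ := fun j =>
    (A * (((j : ℝ) + 1) * Real.log 2 + L₀) + |B| + 1) ^ 2 * (D / 2 ^ j / 100) ^ 2 with hw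
  have hw0 : ∀ j, 0 ≤ w j := fun j => by positivity
  have hfx : ∀ x ∈ S, ((q x : ℝ) + 1) ^ 2 * (infDist x Ωᶜ / 100) ^ 2 ≤ w (jOf x) := by
    intro x hx
    have hd := hdpos x hx
    obtain ⟨h1, h2⟩ := hclass x hx
    -- `log (1/d) ≤ (j+1) log 2 + L₀`
    have hlog : Real.log (1 / infDist x Ωᶜ) ≤ ((jOf x : ℝ) + 1) * Real.log 2 + L₀ := by
      have e : (1 : ℝ) / infDist x Ωᶜ = (D / infDist x Ωᶜ) * (1 / D) := by field_simp
      rw [e, Real.log_mul (by positivity) (by positivity)]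
      have h3 : Real.log (D / infDist x Ωᶜ) < ((jOf x : ℝ) + 1) * Real.log 2 := by
        have := (hjOf x hx).2
        calc Real.log (D / infDist x Ωᶜ) < Real.log (2 ^ (jOf x + 1)) :=
              Real.log_lt_log (by positivity) this
          _ = ((jOf x : ℝ) + 1) * Real.log 2 := by rw [Real.log_pow]; push_cast; ring
      have h4 : Real.log (1 / D) ≤ L₀ := le_abs_self _
      linarith
    have hq1 : (q x : ℝ) + 1 ≤ A * (((jOf x : ℝ) + 1) * Real.log 2 + L₀) + |B| + 1 := by
      have := hq x hx
      have hB : B ≤ |B| := le_abs_self B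
      nlinarith [mul_le_mul_of_nonneg_left hlog hA]
    have hq0 : 0 ≤ (q x : ℝ) + 1 := by positivity
    simp only [hw]
    gcongr
  -- the majorant series is summable
  have hθn : ‖θ‖ < 1 := by rw [Real.norm_eq_abs, abs_of_nonneg hθ0]; exact hθ1
  set Kc : ℝ := C₀ * 64 / Real.pi with hKc
  have hKc0 : 0 ≤ Kc := by positivity
  set a : ℝ := A * Real.log 2 with ha
  set b : ℝ := A * (Real.log 2 + L₀) + |B| + 1 with hb
  set T : ℕ → ℝ := fun j => Kc * ((a * j + b) ^ 2 * θ ^ (j - jD)) with hT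
  have hT0 : ∀ j, 0 ≤ T j := fun j => by positivity
  have htail : ∀ j, jD + n₁ ≤ j → N j * w j = T j := by
    intro j hj
    simp only [hN, if_pos hj, hw, hT, hKc, ha, hb]
    have hp : (2 : ℝ) ^ (j + 1) = 2 ^ j * 2 := pow_succ 2 j
    rw [hp]
    field_simp
    ring
  have hsumT : Summable T := by
    have h2 : Summable fun n : ℕ => ((n : ℝ) ^ 2 * θ ^ n) := summable_pow_mul_geometric_of_norm_lt_one 2 hθn
    have h1 : Summable fun n : ℕ => ((n : ℝ) ^ 1 * θ ^ n) := summable_pow_mul_geometric_of_norm_lt_one 1 hθn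
    have h0 : Summable fun n : ℕ => θ ^ n := summable_geometric_of_lt_one hθ0 hθ1
    have hshift : Summable fun n : ℕ => T (n + jD) := by
      have : (fun n : ℕ => T (n + jD)) = fun n : ℕ =>
          Kc * a ^ 2 * ((n : ℝ) ^ 2 * θ ^ n) + 2 * Kc * a * (a * jD + b) * ((n : ℝ) ^ 1 * θ ^ n) +
            Kc * (a * jD + b) ^ 2 * θ ^ n := by
        funext n
        simp only [hT, Nat.add_sub_cancel]
        push_cast
        ring
      rw [this]
      exact ((h2.mul_left _).add (h1.mul_left _)).add (h0.mul_left _)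
    exact (summable_nat_add_iff jD).1 hshift
  -- majorant `M j ≥ N j * w j` for all `j`
  set M : ℕ → ℝ := fun j => T j + (if j < jD + n₁ then N j * w j else 0) with hM
  have hMsum : Summable M := by
    refine hsumT.add (summable_of_ne_finset_zero (s := Finset.range (jD + n₁)) fun j hj => ?_)
    rw [Finset.mem_range] at hj
    simp [hj]
  have hNM : ∀ j, N j * w j ≤ M j := by
    intro j
    simp only [hM]
    by_cases hj : j < jD + n₁
    · rw [if_pos hj]
      linarith [hT0 j]
    · rw [if_neg hj, add_zero, htail j (not_lt.1 hj)]
  have hM0 : ∀ j, 0 ≤ M j := fun j => (mul_nonneg (hN0 j) (hw0 j)).trans (hNM j)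
  -- CONCLUSION: every finite sum is bounded by `Σ M`
  refine summable_of_sum_le (fun x => by positivity) (c := ∑' j, M j) fun u => ?_
  calc ∑ x ∈ u, ((q x : ℝ) + 1) ^ 2 * (infDist (x : ℂ) Ωᶜ / 100) ^ 2
      ≤ ∑ x ∈ u, w (jOf x) := Finset.sum_le_sum fun x _ => hfx x x.2
    _ = ∑ j ∈ u.image (fun x : S => jOf x), ∑ x ∈ u.filter (fun x : S => jOf x = j), w (jOf x) := by
        rw [Finset.sum_fiberwise_of_maps_to (fun x hx => Finset.mem_image_of_mem _ hx)]
    _ = ∑ j ∈ u.image (fun x : S => jOf x), ((u.filter fun x : S => jOf x = j).card : ℝ) * w j := by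
        refine Finset.sum_congr rfl fun j _ => ?_
        rw [Finset.sum_congr rfl fun x hx => by rw [(Finset.mem_filter.1 hx).2], Finset.sum_const,
          nsmul_eq_mul]
    _ ≤ ∑ j ∈ u.image (fun x : S => jOf x), N j * w j := by
        refine Finset.sum_le_sum fun j _ => mul_le_mul_of_nonneg_right ?_ (hw0 j)
        -- the fibre maps injectively into a class-`j` family of points of `S`
        have hinj : Set.InjOn (fun x : S => (x : ℂ)) ↑(u.filter fun x : S => jOf x = j) :=
          fun x _ y _ h => Subtype.ext h
        rw [← Finset.card_image_of_injOn hinj]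
        refine hcount j _ fun z hz => ?_
        obtain ⟨x, hx, rfl⟩ := Finset.mem_image.1 hz
        exact ⟨x.2, (Finset.mem_filter.1 hx).2⟩
    _ ≤ ∑ j ∈ u.image (fun x : S => jOf x), M j := Finset.sum_le_sum fun j _ => hNM j
    _ ≤ ∑' j, M j := hMsum.sum_le_tsum _ fun j _ => hM0 j

end Literature.Probability.RandomPlanarGeometry
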